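import Mathlib
import Summits.MatrixMultiplication.MatrixMultiplication.Theorems.LevelGradedCohnUmansLevelOneGL2DesignsStubTangencySetsUnitalBoundCounting

/-!
# The unital bound for `stub_tangencySets`, part 2: `q·|S|² ≤ (q² - 1)²` and its integer refinement

Wall-breaker axis "Hermitian unital constructions" (k7/12) for the stub `stub_tangencySets` of the
crux `LevelOneGL2Designs` (stmt-MatrixMultiplication-14080, route LevelGradedCohnUmans).

For every finite field `F` with `q` elements and every `S ⊆ F² × F²` with the stub's property
`f.1 ⬝ᵥ f'.2 = 1 ↔ f = f'` (`N = |S|`):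

* `srs_line_moments` — the double count.  The point set `X = {f.1}` (`|X| = N`, `0 ∉ X`) meets the
  `q+1` lines through the origin `N` times in total and the `N` tangents `{z | f.2 ⬝ᵥ z = 1}` once
  each; NO tangent passes through the origin (`f.2 ⬝ᵥ 0 = 0 ≠ 1`) — this is where the stub's
  normalisation is stronger than the projective one; the second moment over all lines is
  `N(N-1) + N(q+1)` (two points determine a line).  Cauchy–Schwarz (and its integer form
  `(2a+1)k ≤ k² + a(a+1)`) on the origin pencil and on the remaining `q²-1-N` lines.
* `srs_card_sq_mul_card_le` — **`q N² ≤ (q²-1)²`**, i.e. `N ≤ (q²-1)/√q = q^{3/2} - q^{-1/2}`, via the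
  polynomial identity
  `(q-1)³N((q²-1)² - qN²) = (q-1)(q²-1-N)·CS₁ + (q²-1)·CS₂` in the two Cauchy–Schwarz defects.
* `srs_count_ineq` — the integer refinement
  `(2a+1)N + (2b+1)(q-1)N + N b(b+1) ≤ N² + (q-1)N + (q+1)a(a+1) + (q²-1)b(b+1)` for all `a b : ℕ`.

Why this is the UNITAL bound: for `q = r²` it gives `N ≤ r³ - 1`, and the Hermitian system of
`…StubTangencySetsHermitian.hermitian_srs` has exactly `r³ - 1` flags (part 3,
`hermitian_srs_extremal`): the classical unital is extremal for the stub's matrix on the nose.  Over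
a prime field the same count reads `p·T(p)² ≤ (p²-1)²` and sharpens the tree's
`srs_card_le_rpow` (`≤ p^{3/2} + p`, Vinh's form), `srs_card_sq_le` and the registered
`stub_tangency_isw_bound` (`(N-1)² ≤ p³`, proved from it in part 3).  What it does NOT do: no saving in
the exponent `3/2` for primes (Hunter–Pohoata–Verstraëte–Zhang, arXiv:2601.19879, Conj. 10.2 —
equivalent in strength to power savings for Paley cliques and Furstenberg–Sárközy); integrality of
the intersection numbers only moves the additive constant.
Sources: Illés–Szőnyi–Wettl 1991 (projective form `|SRS| ≤ q√q + 1`), Thas / Kiss 2008 survey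
Thm 1.3 (semiovals), Vinh 2011 (spectral form).  Elementary; no definitions.
-/

-- `Summit.MatrixMultiplication.MatrixMultiplication.…` is the tree's mandated summit/problem namespace (D-0017).
set_option linter.dupNamespace false

namespace Summit.MatrixMultiplication.MatrixMultiplication.Theorems.LevelOneGL2Designs.UnitalBound

open Finset Matrix

variable {F : Type*} [Field F] [Fintype F] [DecidableEq F]

/-! ## The moments of a strong representative system -/

section SRS

/-- Integer convexity: `(2a+1)k ≤ k² + a(a+1)` for natural numbers (`(k-a)(k-a-1) ≥ 0`).
[elementary] -/
theorem two_mul_add_one_mul_le_sq_add (k a : ℕ) : (2 * a + 1) * k ≤ k ^ 2 + a * (a + 1) := by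
  have : ((2 * a + 1) * k : ℤ) ≤ (k : ℤ) ^ 2 + a * (a + 1) := by
    rcases le_or_gt (k : ℤ) a with h | h
    · nlinarith [sq_nonneg ((k : ℤ) - a)]
    · have h' : (a : ℤ) + 1 ≤ k := h
      nlinarith [sq_nonneg ((k : ℤ) - a - 1)]
  exact_mod_cast this

/-- **Line moments of a strong representative system** (the counting behind the unital bound).
Let `S ⊆ F² × F²` satisfy `f.1 ⬝ᵥ f'.2 = 1 ↔ f = f'` (the stub's matrix), `N = |S|`,
`q = |F|`, `X = {f.1}` its point set (`|X| = N`, `0 ∉ X`).  Count incidences of `X` with the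
affine lines, each line `{z | u ⬝ᵥ z = t}` being represented `q - 1` times by its pairs
`(u, t)`, `u ≠ 0`.  With `A = Σ_{u ≠ 0} #{z ∈ X | u ⬝ᵥ z = 0}²` (lines through the origin),
`B'` / `σ'` the sum of squares / the sum of `#{z ∈ X | u ⬝ᵥ z = t}` over the pairs with `t ≠ 0`
that are NOT multiples `(c • f.2, c)` of a tangent, and `m` the number of such pairs:
`A + B' + N(q-1) = (q-1)N² + (q²-q)N` (second moment: two points lie on one line),
`σ' + N(q-1) = (q²-q)N`, `m + N(q-1) = (q²-1)(q-1)` (the `N(q-1)` tangent pairs carry exactly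
one point each), the Cauchy–Schwarz bounds `((q-1)N)² ≤ (q²-1)A`, `σ'² ≤ m B'`, and their
integer refinements `(2a+1)(q-1)N ≤ A + (q²-1)a(a+1)`, `(2b+1)σ' ≤ B' + m b(b+1)`.
[folklore; the projective count is Illés–Szőnyi–Wettl 1991 / Thas] -/
theorem srs_line_moments (S : Finset ((Fin 2 → F) × (Fin 2 → F)))
    (hS : ∀ f ∈ S, ∀ f' ∈ S, (f.1 ⬝ᵥ f'.2 = 1 ↔ f = f')) :
    ∃ A B' σ' m : ℕ,
      A + B' + S.card * (Fintype.card F - 1)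
          = (Fintype.card F - 1) * S.card ^ 2 + (Fintype.card F ^ 2 - Fintype.card F) * S.card ∧
      σ' + S.card * (Fintype.card F - 1) = (Fintype.card F ^ 2 - Fintype.card F) * S.card ∧
      m + S.card * (Fintype.card F - 1) = (Fintype.card F ^ 2 - 1) * (Fintype.card F - 1) ∧
      ((Fintype.card F - 1) * S.card) ^ 2 ≤ (Fintype.card F ^ 2 - 1) * A ∧
      σ' ^ 2 ≤ m * B' ∧
      (∀ a : ℕ, (2 * a + 1) * ((Fintype.card F - 1) * S.card) ≤ A + (Fintype.card F ^ 2 - 1) * (a * (a + 1))) ∧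
      (∀ b : ℕ, (2 * b + 1) * σ' ≤ B' + m * (b * (b + 1))) := by
  classical
  set q := Fintype.card F with hq
  set X : Finset (Fin 2 → F) := S.image Prod.fst with hXdef
  set NZ := univ.filter (fun u : Fin 2 → F => u ≠ 0) with hNZ
  set NZF := univ.filter (fun t : F => t ≠ 0) with hNZF
  set P := NZ ×ˢ NZF with hP
  -- basic facts about `S`
  have hdiag : ∀ f ∈ S, f.1 ⬝ᵥ f.2 = 1 := fun f hf => (hS f hf f hf).2 rfl
  have hinj1 : Set.InjOn Prod.fst (S : Set ((Fin 2 → F) × (Fin 2 → F))) := by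
    intro f hf f' hf' h
    exact (hS f hf f' hf').1 (by rw [h]; exact hdiag f' hf')
  have hXcard : X.card = S.card := card_image_of_injOn hinj1
  have hX0 : ∀ z ∈ X, z ≠ 0 := by
    intro z hz h0
    obtain ⟨f, hf, rfl⟩ := mem_image.1 hz
    have := hdiag f hf
    rw [h0, zero_dotProduct] at this
    exact zero_ne_one this
  have hv0 : ∀ f ∈ S, f.2 ≠ 0 := by
    intro f hf h0
    have := hdiag f hf
    rw [h0, dotProduct_zero] at this
    exact zero_ne_one this
  -- cardinalities
  have hNZcard : NZ.card = q ^ 2 - 1 := card_filter_ne_zero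
  have hNZFcard : NZF.card = q - 1 := by
    rw [hNZF, filter_ne' univ (0 : F), card_erase_of_mem (mem_univ _), card_univ]
  have hPcard : P.card = (q ^ 2 - 1) * (q - 1) := by rw [hP, card_product, hNZcard, hNZFcard]
  -- the line counts
  set k : (Fin 2 → F) → F → ℕ := fun u t => (X.filter fun z => u ⬝ᵥ z = t).card with hk
  have hsumO : ∑ u ∈ NZ, k u 0 = (q - 1) * X.card := sum_card_filter_orth X hX0
  have hsumP : ∑ l ∈ P, k l.1 l.2 = (q ^ 2 - q) * X.card := sum_card_filter_pairs X hX0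
  have hsplit : ∀ g : F → ℕ, ∑ t : F, g t = g 0 + ∑ t ∈ NZF, g t := by
    intro g
    rw [hNZF, filter_ne' univ (0 : F)]
    exact (add_sum_erase univ g (mem_univ (0 : F))).symm
  have hE : ∑ u ∈ NZ, k u 0 ^ 2 + ∑ l ∈ P, k l.1 l.2 ^ 2
      = (q - 1) * X.card ^ 2 + (q ^ 2 - q) * X.card := by
    rw [← sum_sum_sq_card_filter X hX0, hP, sum_product, ← sum_add_distrib]
    exact sum_congr rfl fun u _ => (hsplit fun t => k u t ^ 2).symm
  -- the tangent family `(c • f.2, c)`, `f ∈ S`, `c ≠ 0`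
  let τ : ((Fin 2 → F) × (Fin 2 → F)) × F → (Fin 2 → F) × F := fun fc => (fc.2 • fc.1.2, fc.2)
  set T := (S ×ˢ NZF).image τ with hT
  have hτinj : Set.InjOn τ ((S ×ˢ NZF : Finset _) : Set (((Fin 2 → F) × (Fin 2 → F)) × F)) := by
    rintro ⟨f, c⟩ hfc ⟨f', c'⟩ hfc' h
    rw [mem_coe, mem_product] at hfc hfc'
    have hc : c = c' := congrArg Prod.snd h
    subst hc
    have hc0 : c ≠ 0 := (mem_filter.1 hfc.2).2
    have h1 : c • f.2 = c • f'.2 := congrArg Prod.fst h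
    have h2 : f.2 = f'.2 := smul_right_injective (Fin 2 → F) hc0 h1
    have hff : f' = f := (hS f' hfc'.1 f hfc.1).1 (by rw [h2]; exact hdiag f' hfc'.1)
    rw [hff]
  have hTcard : T.card = S.card * (q - 1) := by
    rw [hT, card_image_of_injOn hτinj, card_product, hNZFcard]
  have hTsub : T ⊆ P := by
    intro l hl
    obtain ⟨⟨f, c⟩, hfc, rfl⟩ := mem_image.1 hl
    rw [mem_product] at hfc
    have hc0 : c ≠ 0 := (mem_filter.1 hfc.2).2
    refine mem_product.2 ⟨mem_filter.2 ⟨mem_univ _, ?_⟩, hfc.2⟩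
    exact smul_ne_zero hc0 (hv0 f hfc.1)
  have hTk : ∀ l ∈ T, k l.1 l.2 = 1 := by
    intro l hl
    obtain ⟨⟨f, c⟩, hfc, rfl⟩ := mem_image.1 hl
    rw [mem_product] at hfc
    have hc0 : c ≠ 0 := (mem_filter.1 hfc.2).2
    show (X.filter fun z => (c • f.2) ⬝ᵥ z = c).card = 1
    rw [card_eq_one]
    refine ⟨f.1, ?_⟩
    ext z
    simp only [mem_filter, mem_singleton, hXdef, mem_image]
    constructor
    · rintro ⟨⟨f', hf', rfl⟩, h⟩
      rw [smul_dotProduct, smul_eq_mul, dotProduct_comm] at h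
      have h1 : f'.1 ⬝ᵥ f.2 = 1 := mul_left_cancel₀ hc0 (h.trans (mul_one c).symm)
      exact congrArg Prod.fst ((hS f' hf' f hfc.1).1 h1)
    · rintro rfl
      refine ⟨⟨f, hfc.1, rfl⟩, ?_⟩
      rw [smul_dotProduct, smul_eq_mul, dotProduct_comm, hdiag f hfc.1, mul_one]
  have hTsum : ∑ l ∈ T, k l.1 l.2 = T.card := by
    rw [card_eq_sum_ones]
    exact sum_congr rfl hTk
  have hTsum2 : ∑ l ∈ T, k l.1 l.2 ^ 2 = T.card := by
    rw [card_eq_sum_ones]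
    exact sum_congr rfl fun l hl => by rw [hTk l hl, one_pow]
  have hsdiff1 : ∑ l ∈ P \ T, k l.1 l.2 + T.card = ∑ l ∈ P, k l.1 l.2 := by
    rw [← hTsum]; exact sum_sdiff hTsub
  have hsdiff2 : ∑ l ∈ P \ T, k l.1 l.2 ^ 2 + T.card = ∑ l ∈ P, k l.1 l.2 ^ 2 := by
    rw [← hTsum2]; exact sum_sdiff hTsub
  have hcardPT : (P \ T).card + T.card = P.card := card_sdiff_add_card_eq_card hTsub
  -- Cauchy–Schwarz and integer convexity on the two groups
  have hCS1 : (∑ u ∈ NZ, k u 0) ^ 2 ≤ NZ.card * ∑ u ∈ NZ, k u 0 ^ 2 := sq_sum_le_card_mul_sum_sq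
  have hCS2 : (∑ l ∈ P \ T, k l.1 l.2) ^ 2 ≤ (P \ T).card * ∑ l ∈ P \ T, k l.1 l.2 ^ 2 :=
    sq_sum_le_card_mul_sum_sq
  have hI1 : ∀ a : ℕ, (2 * a + 1) * ∑ u ∈ NZ, k u 0 ≤ ∑ u ∈ NZ, k u 0 ^ 2 + NZ.card * (a * (a + 1)) := by
    intro a
    have hc : NZ.card * (a * (a + 1)) = ∑ _u ∈ NZ, a * (a + 1) := by rw [sum_const, smul_eq_mul]
    rw [mul_sum, hc, ← sum_add_distrib]
    exact sum_le_sum fun u _ => two_mul_add_one_mul_le_sq_add _ _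
  have hI2 : ∀ b : ℕ, (2 * b + 1) * ∑ l ∈ P \ T, k l.1 l.2
      ≤ ∑ l ∈ P \ T, k l.1 l.2 ^ 2 + (P \ T).card * (b * (b + 1)) := by
    intro b
    have hc : (P \ T).card * (b * (b + 1)) = ∑ _l ∈ P \ T, b * (b + 1) := by
      rw [sum_const, smul_eq_mul]
    rw [mul_sum, hc, ← sum_add_distrib]
    exact sum_le_sum fun l _ => two_mul_add_one_mul_le_sq_add _ _
  refine ⟨∑ u ∈ NZ, k u 0 ^ 2, ∑ l ∈ P \ T, k l.1 l.2 ^ 2, ∑ l ∈ P \ T, k l.1 l.2, (P \ T).card,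
    ?_, ?_, ?_, ?_, hCS2, ?_, ?_⟩
  · rw [← hXcard, ← hE, ← hsdiff2, hTcard, hXcard]
    ring
  · rw [← hXcard, ← hsumP, ← hsdiff1, hTcard, hXcard]
  · rw [← hPcard, ← hcardPT, hTcard]
  · rw [← hXcard, ← hsumO, ← hNZcard]
    exact hCS1
  · intro a
    rw [← hXcard, ← hsumO, ← hNZcard]
    exact hI1 a
  · exact hI2

set_option maxHeartbeats 400000 in
/-- **The unital bound for the stub's matrix.**  For every finite field `F` with `q` elements
and every `S ⊆ F² × F²` with `f.1 ⬝ᵥ f'.2 = 1 ↔ f = f'` (an induced matching between the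
non-zero points and the origin-avoiding lines of `AG(2,q)`): `q · |S|² ≤ (q² - 1)²`, i.e.
`|S| ≤ (q² - 1)/√q = q^{3/2} - q^{-1/2}`.  For `q = r²` this reads `|S| ≤ r³ - 1`, attained by the
Hermitian unital (`FlagLine.TangencyHermitian.hermitian_srs`; see `srs_card_le_of_card_sq`,
`hermitian_srs_extremal`); for `q = p` prime it caps the stub's constant at `c < 1` and sharpens
the Vinh / Illés–Szőnyi–Wettl forms `|S| ≤ p^{3/2} + p`, `(|S| - 1)² ≤ p³` already in the tree.
Proof: `srs_line_moments` and the identity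
`(q-1)³ N ((q²-1)² - qN²) = (q-1)(q²-1-N)·[(q²-1)A - (q-1)²N²] + (q²-1)·[(q-1)(q²-1-N)B' - (q-1)⁴N²]`
(both brackets are the Cauchy–Schwarz defects, hence `≥ 0`). [folklore] -/
theorem srs_card_sq_mul_card_le (S : Finset ((Fin 2 → F) × (Fin 2 → F)))
    (hS : ∀ f ∈ S, ∀ f' ∈ S, (f.1 ⬝ᵥ f'.2 = 1 ↔ f = f')) :
    Fintype.card F * S.card ^ 2 ≤ (Fintype.card F ^ 2 - 1) ^ 2 := by
  obtain ⟨A, B', σ', m, hE, hs1, hm, hCS1, hCS2, -, -⟩ := srs_line_moments S hS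
  set q := Fintype.card F with hq
  set N := S.card with hN
  have hq2 : 2 ≤ q := by
    have : 1 < Fintype.card F := Fintype.one_lt_card
    omega
  have hq1 : 1 ≤ q := by omega
  have hqq : q ≤ q ^ 2 := by nlinarith
  have hq21 : 1 ≤ q ^ 2 := by nlinarith
  -- `N ≤ q² - 1` follows from `hm`
  have hNle : N * (q - 1) ≤ (q ^ 2 - 1) * (q - 1) := by rw [← hm]; exact Nat.le_add_left _ _
  have hN' : N ≤ q ^ 2 - 1 := Nat.le_of_mul_le_mul_right hNle (by omega)
  rcases Nat.eq_zero_or_pos N with hN0 | hNpos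
  · rw [hN0]; simp
  -- pass to `ℤ`
  have hE' : (A : ℤ) + B' + N * (q - 1) = (q - 1) * N ^ 2 + (q ^ 2 - q) * N := by
    have := hE; zify [hq1, hqq] at this; linarith
  have hs1' : (σ' : ℤ) + N * (q - 1) = (q ^ 2 - q) * N := by
    have := hs1; zify [hq1, hqq] at this; linarith
  have hm' : (m : ℤ) + N * (q - 1) = (q ^ 2 - 1) * (q - 1) := by
    have := hm; zify [hq1, hq21] at this; linarith
  have hCS1' : ((q : ℤ) - 1) ^ 2 * N ^ 2 ≤ (q ^ 2 - 1) * A := by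
    have := hCS1; zify [hq1, hq21] at this
    calc ((q : ℤ) - 1) ^ 2 * N ^ 2 = ((q - 1) * N) ^ 2 := by ring
      _ ≤ _ := this
  have hCS2' : (σ' : ℤ) ^ 2 ≤ m * B' := by exact_mod_cast hCS2
  -- the certificate
  have key : ((q : ℤ) - 1) ^ 3 * N * ((q ^ 2 - 1) ^ 2 - q * N ^ 2)
      = (q - 1) * (q ^ 2 - 1 - N) * ((q ^ 2 - 1) * A - (q - 1) ^ 2 * N ^ 2)
        + (q ^ 2 - 1) * ((q - 1) * (q ^ 2 - 1 - N) * B' - (q - 1) ^ 4 * N ^ 2) := by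
    have hB' : (B' : ℤ) = (q - 1) * N ^ 2 + (q ^ 2 - q) * N - N * (q - 1) - A := by linarith
    have hσ' : (σ' : ℤ) = (q ^ 2 - q) * N - N * (q - 1) := by linarith
    have hmm : (m : ℤ) = (q ^ 2 - 1) * (q - 1) - N * (q - 1) := by linarith
    rw [hB']
    ring
  have hmB : ((q : ℤ) - 1) ^ 4 * (N : ℤ) ^ 2 ≤ ((q : ℤ) - 1) * ((q : ℤ) ^ 2 - 1 - N) * (B' : ℤ) := by
    have hσ' : (σ' : ℤ) = (q - 1) ^ 2 * N := by linear_combination hs1'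
    have hmm : (m : ℤ) = (q - 1) * (q ^ 2 - 1 - N) := by linear_combination hm'
    calc ((q : ℤ) - 1) ^ 4 * (N : ℤ) ^ 2 = ((σ' : ℤ)) ^ 2 := by rw [hσ']; ring
      _ ≤ (m : ℤ) * (B' : ℤ) := hCS2'
      _ = ((q : ℤ) - 1) * ((q : ℤ) ^ 2 - 1 - N) * (B' : ℤ) := by rw [hmm]
  have hq1z : (1 : ℤ) ≤ q := by exact_mod_cast hq1
  have hq2z : (2 : ℤ) ≤ q := by exact_mod_cast hq2
  have hNz : (N : ℤ) ≤ (q : ℤ) ^ 2 - 1 := by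
    have := hN'
    zify [hq21] at this
    exact this
  have hNposz : (0 : ℤ) < N := by exact_mod_cast hNpos
  have hpos : (0 : ℤ) ≤ ((q : ℤ) - 1) ^ 3 * N * ((q ^ 2 - 1) ^ 2 - q * N ^ 2) := by
    rw [key]
    have h1 : (0 : ℤ) ≤ (q : ℤ) - 1 := by linarith
    have h2 : (0 : ℤ) ≤ (q : ℤ) ^ 2 - 1 - N := by linarith
    have h3 : (0 : ℤ) ≤ (q : ℤ) ^ 2 - 1 := by linarith [hNz, hNposz.le]
    have h4 : (0 : ℤ) ≤ ((q : ℤ) ^ 2 - 1) * A - (q - 1) ^ 2 * N ^ 2 := sub_nonneg.2 hCS1'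
    have h5 : (0 : ℤ) ≤ ((q : ℤ) - 1) * ((q : ℤ) ^ 2 - 1 - N) * B' - (q - 1) ^ 4 * N ^ 2 :=
      sub_nonneg.2 hmB
    exact add_nonneg (mul_nonneg (mul_nonneg h1 h2) h4) (mul_nonneg h3 h5)
  have hfac : (0 : ℤ) < ((q : ℤ) - 1) ^ 3 * N := mul_pos (pow_pos (by linarith) 3) hNposz
  have hfin : (0 : ℤ) ≤ ((q : ℤ) ^ 2 - 1) ^ 2 - q * N ^ 2 := nonneg_of_mul_nonneg_right hpos hfac
  have hfin' : (q : ℤ) * N ^ 2 ≤ ((q : ℤ) ^ 2 - 1) ^ 2 := sub_nonneg.1 hfin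
  zify [hq21]
  exact hfin'

/-- **Integer refinement of the unital bound.**  In the setting of `srs_card_sq_mul_card_le`
(`q = |F|`, `N = |S|`), for all natural numbers `a, b`:
`(2a+1)N + (2b+1)(q-1)N + N·b(b+1) ≤ N² + (q-1)N + (q+1)·a(a+1) + (q²-1)·b(b+1)`.
(Group the non-tangent lines into the `q+1` through the origin — none is a tangent, since the
lines `{z | f.2 ⬝ᵥ z = 1}` miss `0` — and the `q²-1-N` others; their intersection numbers with
the point set are integers with prescribed sums `N`, `(q-1)N` and total second moment
`N(N+q-1)`; `a`, `b` are trial integer parts of the two means.)  With the optimal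
`a ≈ N/(q+1)`, `b ≈ (q-1)N/(q²-1-N)` this is slightly stronger than `qN² ≤ (q²-1)²` and gives the
exact values `T(3) = 4`, `T(5) = 10`, `T(7) = 17` of the siege census. [folklore] -/
theorem srs_count_ineq (S : Finset ((Fin 2 → F) × (Fin 2 → F)))
    (hS : ∀ f ∈ S, ∀ f' ∈ S, (f.1 ⬝ᵥ f'.2 = 1 ↔ f = f')) (a b : ℕ) :
    (2 * a + 1) * S.card + (2 * b + 1) * (Fintype.card F - 1) * S.card + S.card * (b * (b + 1))
      ≤ S.card ^ 2 + (Fintype.card F - 1) * S.card + (Fintype.card F + 1) * (a * (a + 1))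
        + (Fintype.card F ^ 2 - 1) * (b * (b + 1)) := by
  obtain ⟨A, B', σ', m, hE, hs1, hm, -, -, hI1, hI2⟩ := srs_line_moments S hS
  set q := Fintype.card F with hq
  set N := S.card with hN
  have hq2 : 2 ≤ q := by
    have : 1 < Fintype.card F := Fintype.one_lt_card
    omega
  have hq1 : 1 ≤ q := by omega
  have hqq : q ≤ q ^ 2 := by nlinarith
  have hq21 : 1 ≤ q ^ 2 := by nlinarith
  specialize hI1 a
  specialize hI2 b
  -- pass to `ℤ`
  have hE' : (A : ℤ) + B' + N * (q - 1) = (q - 1) * N ^ 2 + (q ^ 2 - q) * N := by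
    have := hE; zify [hq1, hqq] at this; linarith
  have hs1' : (σ' : ℤ) + N * (q - 1) = (q ^ 2 - q) * N := by
    have := hs1; zify [hq1, hqq] at this; linarith
  have hm' : (m : ℤ) + N * (q - 1) = (q ^ 2 - 1) * (q - 1) := by
    have := hm; zify [hq1, hq21] at this; linarith
  have hI1' : (2 * (a : ℤ) + 1) * ((q - 1) * N) ≤ A + (q ^ 2 - 1) * (a * (a + 1)) := by
    have := hI1; zify [hq1, hq21] at this; linarith
  have hI2' : (2 * (b : ℤ) + 1) * σ' ≤ B' + m * (b * (b + 1)) := by exact_mod_cast hI2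
  have key : ((q : ℤ) - 1) * ((N ^ 2 + (q - 1) * N + (q + 1) * (a * (a + 1)) + (q ^ 2 - 1) * (b * (b + 1)))
        - ((2 * a + 1) * N + (2 * b + 1) * (q - 1) * N + N * (b * (b + 1))))
      = (A + (q ^ 2 - 1) * (a * (a + 1)) - (2 * a + 1) * ((q - 1) * N))
        + (B' + m * (b * (b + 1)) - (2 * b + 1) * σ') := by
    linear_combination (-1 : ℤ) * hE' + (2 * (b : ℤ) + 1) * hs1' + (-((b : ℤ) * (b + 1))) * hm'
  have hpos : (0 : ℤ) ≤ ((q : ℤ) - 1) * ((N ^ 2 + (q - 1) * N + (q + 1) * (a * (a + 1)) + (q ^ 2 - 1) * (b * (b + 1)))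
        - ((2 * a + 1) * N + (2 * b + 1) * (q - 1) * N + N * (b * (b + 1)))) := by
    rw [key]
    apply add_nonneg <;> linarith
  have hfac : (0 : ℤ) < (q : ℤ) - 1 := by
    have : (2 : ℤ) ≤ q := by exact_mod_cast hq2
    linarith
  have hfin : ((2 * (a : ℤ) + 1) * N + (2 * b + 1) * (q - 1) * N + N * (b * (b + 1)))
      ≤ N ^ 2 + (q - 1) * N + (q + 1) * (a * (a + 1)) + (q ^ 2 - 1) * (b * (b + 1)) :=
    sub_nonneg.1 (nonneg_of_mul_nonneg_right hpos hfac)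
  zify [hq1, hq21]
  exact hfin

end SRS

end Summit.MatrixMultiplication.MatrixMultiplication.Theorems.LevelOneGL2Designs.UnitalBound
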